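import Literature.NumberTheory.Sieve.BombieriFriedlanderIwaniecDispersion
import Literature.NumberTheory.Sieve.DivisorPowerSums
import Literature.NumberTheory.Sieve.FriedlanderIwaniecPrimesSmoothCutoff
import HarnessLib

/-!
# Bombieri–Friedlander–Iwaniec 1986, Theorem 5 — step 1: the smoothed weight and the smoothing error (12.1)

Topic `Literature/NumberTheory/Sieve`, companion to `BombieriFriedlanderIwaniecDispersion` (which
vendors Theorem 5 of E. Bombieri, J. B. Friedlander, H. Iwaniec, *Primes in arithmetic progressions
to large moduli*, Acta Math. 156 (1986), 203–251, as the named fact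
`Literature.NumberTheory.Sieve.BombieriFriedlanderIwaniecTheorem5`).  This is the first of the
files formalising the PROVABLE part of the proof of Theorem 5 (§12, pp. 235–237): everything in
§12 except the bound for the exponential sum `𝓔` (Lemma 9, which rests on Lemma 1 = the
Deshouillers–Iwaniec estimates for sums of Kloosterman sums).  Everything here is PROVED; no named
facts are introduced.

## Contents (BFI §12, p. 235–236)

* `BFI.dispDw a S N Q R w β γ δ` — the dispersion sum `𝒟` of (3.1) with the sharp cut-off
  `m ∼ M` replaced by a weight `w(m)` over a finite range `S`; `BFI.dispD_eq_dispDw`,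
  `BFI.dispDw_indicator` (`𝒟 = dispDw` with `w = 1_{m∼M}`), `BFI.dispDw_sub` (linearity).
* `BFI.abs_dispDw_le_of_support` — the trivial bound for a weight `|w| ≤ 1` supported on a set `T`:
  `|dispDw(w)| ≤ #T ∑|β_n| (D₀^{2B+2} + ∑_{q∼Q} τ(q)^{B+1}/q · ∑_{r∼R} τ(r)^{B+1}/r)` where `D₀`
  bounds `τ(mn − a)`; the congruence sums are counted through
  `∑_{qr ∣ l} τ(q)^B τ(r)^B ≤ τ(l)^{2B+2}` (`BFI.sum_dyadic_dvd_rpow_le`), the coprimality sums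
  through `1/φ(qr) ≤ τ(q)τ(r)/(qr)`.
* `BFI.bump M Y` — the smooth weight `α` of p. 235 ("we replace `α_m` by a smooth function `α(m)`,
  say, whose graph is" the plateau `1` on `[M, 2M]` with transitions of length `Y` on both sides),
  built from `Real.smoothTransition`; values in `[0,1]`, support in `[M − Y, 2M + Y]`,
  `BFI.iteratedDeriv_bump` (chain rule), **`BFI.norm_iteratedDeriv_bump_le`** (`|α⁽ⁿ⁾| ≤ 2Kₙ Y⁻ⁿ`),
  `BFI.iteratedDeriv_bump_eq_zero` (the derivatives live on the two transition intervals); the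
  complexification `BFI.bumpC` with `‖α_ℂ‖₁ ≤ M + 2Y`, `‖α_ℂ⁽ⁿ⁾‖₁ ≤ 4Kₙ Y^{1−n}`, and the Fourier
  bounds `|𝓕α(ξ)| ≤ M + 2Y`, `|𝓕α(ξ)| ≤ 4KₙY^{1−n}/(2π|ξ|)ⁿ` (repeated partial integration, via
  `FriedlanderIwaniecPrimesPoisson`).  The constants `Kₙ = BFI.derivConst n` depend on `n` alone.
* `BFI.abs_dispD_sub_dispDw_bump_le` — **the smoothing error (12.1)**: for `0 < Y ≤ M`,
  `|a| ≤ M − Y`, `|𝒟(1_{m∼M}) − dispDw(α)| ≤ (2Y+2) ∑|β_n| (D₀^{2B+2} + ∑τ^{B+1}/q ∑τ^{B+1}/r)`.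

## Deviation from the source

BFI bound the correction (12.1) by Lemma 3 (Shiu's theorem), getting `O(‖β‖ N^{1/2} M x^{−ε/2})`
with the transition length `Y = M x^{−ε/2}`.  Since the vendored Theorem 5 has an existential
saving `x^{−ε'}`, the pointwise divisor bound `τ(l) ≤ C_δ l^δ` (tree: `DivisorBound`) suffices:
with `Y = M x^{−ε₁}` the bound above is `≪ ‖β‖ N^{1/2} M x^{−ε₁/2}` once `δ(2B+2) ≤ ε₁/2`.  The
choice of `Y`, `D₀` and the final `x`-power bookkeeping are left to the assembly file.

## References

* E. Bombieri, J. B. Friedlander, H. Iwaniec, Acta Math. 156 (1986), 203–251, §3 (3.1) p. 214,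
  §12 pp. 235–236. [BombieriFriedlanderIwaniecActa1986]
-/

noncomputable section

open Finset Real MeasureTheory
open scoped ArithmeticFunction.sigma ContDiff FourierTransform

namespace Literature.NumberTheory.Sieve

namespace BFI

/-! ### `𝒟` with a weight on the variable `m` -/

/-- The dispersion sum `𝒟` of BFI (3.1), p. 214, with the sharp range `m ∼ M` replaced by a real
weight `w(m)` summed over a finite set `S` of integers `m` (BFI §12, p. 235: "we replace `α_m` by a
smooth function `α(m)`"):
`∑_{q∼Q, r∼R, (qr,a)=1} γ_q δ_r (∑_{m∈S, n∼N, mn≡a (qr)} w(m) β_n − φ(qr)⁻¹ ∑_{(mn,qr)=1} w(m) β_n)`.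
[cite: BombieriFriedlanderIwaniecActa1986, §3 (3.1) p. 214, §12 p. 235] -/
def dispDw (a : ℤ) (S : Finset ℕ) (N Q R : ℝ) (w β γ δ : ℕ → ℝ) : ℝ :=
  ∑ q ∈ dyadic Q, ∑ r ∈ dyadic R,
    if IsCoprime ((q * r : ℕ) : ℤ) a then
      γ q * δ r *
        ((∑ m ∈ S, ∑ n ∈ dyadic N,
            if ((m * n : ℕ) : ZMod (q * r)) = (a : ZMod (q * r)) then w m * β n else 0) -
          (∑ m ∈ S, ∑ n ∈ dyadic N,
            if (m * n).Coprime (q * r) then w m * β n else 0) / (Nat.totient (q * r) : ℝ))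
    else 0

/-- `𝒟` is `dispDw` with `S = {m ∼ M}`. [folklore] -/
theorem dispD_eq_dispDw (a : ℤ) (M N Q R : ℝ) (α β γ δ : ℕ → ℝ) :
    dispD a M N Q R α β γ δ = dispDw a (dyadic M) N Q R α β γ δ := rfl

/-- For `S ⊇ {m ∼ M}`, `𝒟` is `dispDw` over `S` with the weight `1_{m ∼ M} · α`. [folklore] -/
theorem dispDw_indicator (a : ℤ) {M : ℝ} {S : Finset ℕ} (hS : dyadic M ⊆ S) (N Q R : ℝ)
    (α β γ δ : ℕ → ℝ) :
    dispDw a S N Q R (fun m => if m ∈ dyadic M then α m else 0) β γ δ = dispD a M N Q R α β γ δ := by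
  unfold dispDw dispD
  refine Finset.sum_congr rfl fun q _ => Finset.sum_congr rfl fun r _ => ?_
  have key : ∀ (P : ℕ → ℕ → Prop) [∀ m n, Decidable (P m n)],
      (∑ m ∈ S, ∑ n ∈ dyadic N, if P m n then (if m ∈ dyadic M then α m else 0) * β n else 0) =
        ∑ m ∈ dyadic M, ∑ n ∈ dyadic N, if P m n then α m * β n else 0 := by
    intro P _
    rw [← Finset.sum_subset hS]
    · refine Finset.sum_congr rfl fun m hm => Finset.sum_congr rfl fun n _ => ?_
      rw [if_pos hm]
    · intro m _ hm
      refine Finset.sum_eq_zero fun n _ => ?_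
      rw [if_neg hm]
      simp
  rw [key, key]

/-- `dispDw` is additive in the weight. [folklore] -/
theorem dispDw_sub (a : ℤ) (S : Finset ℕ) (N Q R : ℝ) (w₁ w₂ β γ δ : ℕ → ℝ) :
    dispDw a S N Q R w₁ β γ δ - dispDw a S N Q R w₂ β γ δ =
      dispDw a S N Q R (fun m => w₁ m - w₂ m) β γ δ := by
  unfold dispDw
  rw [← Finset.sum_sub_distrib]
  refine Finset.sum_congr rfl fun q _ => ?_
  rw [← Finset.sum_sub_distrib]
  refine Finset.sum_congr rfl fun r _ => ?_
  split_ifs with h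
  · have e : ∀ (P : ℕ → ℕ → Prop) [∀ m n, Decidable (P m n)],
        (∑ m ∈ S, ∑ n ∈ dyadic N, if P m n then (w₁ m - w₂ m) * β n else 0) =
          (∑ m ∈ S, ∑ n ∈ dyadic N, if P m n then w₁ m * β n else 0) -
            ∑ m ∈ S, ∑ n ∈ dyadic N, if P m n then w₂ m * β n else 0 := by
      intro P _
      rw [← Finset.sum_sub_distrib]
      refine Finset.sum_congr rfl fun m _ => ?_
      rw [← Finset.sum_sub_distrib]
      refine Finset.sum_congr rfl fun n _ => ?_
      split_ifs <;> ring
    rw [e, e]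
    ring
  · simp


/-! ### The trivial bound for a weight supported on few integers (BFI (12.1)) -/

/-- A congruence `mn ≡ a (mod k)` gives the divisibility `k ∣ mn - a` in `ℤ`. [folklore] -/
theorem int_dvd_of_natCast_mul_eq {k m n : ℕ} {a : ℤ}
    (h : ((m * n : ℕ) : ZMod k) = (a : ZMod k)) : (k : ℤ) ∣ ((m * n : ℕ) : ℤ) - a := by
  have h' : (((m * n : ℕ) : ℤ) : ZMod k) = ((a : ℤ) : ZMod k) := by rwa [Int.cast_natCast]
  exact (ZMod.intCast_eq_intCast_iff_dvd_sub _ _ _).1 h'.symm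

/-- The number of pairs `(q, r)`, `q ∼ Q`, `r ∼ R`, with `qr ∣ l`, weighted by `τ(q)^B τ(r)^B`, is at
most `τ(l)^{2B+2}` (`q ∣ l` and `r ∣ l`, each factor `≤ τ(l)^B`, at most `τ(l)²` pairs). [folklore] -/
theorem sum_dyadic_dvd_rpow_le {l : ℕ} (hl : l ≠ 0) (Q R : ℝ) {B : ℝ} (hB : 0 ≤ B) :
    ∑ q ∈ dyadic Q, ∑ r ∈ dyadic R,
        (if q * r ∣ l then (σ 0 q : ℝ) ^ B * (σ 0 r : ℝ) ^ B else 0) ≤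
      (σ 0 l : ℝ) ^ (2 * B + 2) := by
  have hτ1 : (1 : ℝ) ≤ (σ 0 l : ℝ) := by exact_mod_cast one_le_sigma_zero hl
  have hτ0 : (0 : ℝ) < (σ 0 l : ℝ) := by linarith
  -- termwise bound
  have h1 : ∀ q ∈ dyadic Q, ∀ r ∈ dyadic R,
      (if q * r ∣ l then (σ 0 q : ℝ) ^ B * (σ 0 r : ℝ) ^ B else 0) ≤
        (if q ∣ l then (σ 0 l : ℝ) ^ B else 0) * (if r ∣ l then (σ 0 l : ℝ) ^ B else 0) := by
    intro q _ r _
    split_ifs with hqr hq hr hr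
    · gcongr
      · exact_mod_cast sigma_zero_le_of_dvd hl hq
      · exact_mod_cast sigma_zero_le_of_dvd hl hr
    · exact absurd (dvd_trans (dvd_mul_left r q) hqr) hr
    · exact absurd (dvd_trans (dvd_mul_right q r) hqr) hq
    · exact absurd (dvd_trans (dvd_mul_right q r) hqr) hq
    all_goals positivity
  -- the count of divisors of `l` in a dyadic range
  have h2 : ∀ X : ℝ, ∑ q ∈ dyadic X, (if q ∣ l then (σ 0 l : ℝ) ^ B else 0) ≤ (σ 0 l : ℝ) ^ (B + 1) := by
    intro X
    rw [← Finset.sum_filter]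
    simp only [Finset.sum_const, nsmul_eq_mul]
    have hsub : (dyadic X).filter (fun q => q ∣ l) ⊆ l.divisors := by
      intro q hq
      rw [Finset.mem_filter] at hq
      exact Nat.mem_divisors.2 ⟨hq.2, hl⟩
    have hcard : (#((dyadic X).filter (fun q => q ∣ l)) : ℝ) ≤ (σ 0 l : ℝ) := by
      rw [ArithmeticFunction.sigma_zero_apply]
      exact_mod_cast Finset.card_le_card hsub
    calc (#((dyadic X).filter (fun q => q ∣ l)) : ℝ) * (σ 0 l : ℝ) ^ B
        ≤ (σ 0 l : ℝ) * (σ 0 l : ℝ) ^ B := by gcongr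
      _ = (σ 0 l : ℝ) ^ (B + 1) := by rw [Real.rpow_add_one hτ0.ne', mul_comm]
  calc ∑ q ∈ dyadic Q, ∑ r ∈ dyadic R,
        (if q * r ∣ l then (σ 0 q : ℝ) ^ B * (σ 0 r : ℝ) ^ B else 0)
      ≤ ∑ q ∈ dyadic Q, ∑ r ∈ dyadic R,
          (if q ∣ l then (σ 0 l : ℝ) ^ B else 0) * (if r ∣ l then (σ 0 l : ℝ) ^ B else 0) :=
        Finset.sum_le_sum fun q hq => Finset.sum_le_sum fun r hr => h1 q hq r hr
    _ = (∑ q ∈ dyadic Q, (if q ∣ l then (σ 0 l : ℝ) ^ B else 0)) *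
          ∑ r ∈ dyadic R, (if r ∣ l then (σ 0 l : ℝ) ^ B else 0) := by
        rw [Finset.sum_mul_sum]
    _ ≤ (σ 0 l : ℝ) ^ (B + 1) * (σ 0 l : ℝ) ^ (B + 1) :=
        mul_le_mul (h2 Q) (h2 R) (Finset.sum_nonneg fun r _ => by positivity) (by positivity)
    _ = (σ 0 l : ℝ) ^ (2 * B + 2) := by
        rw [← Real.rpow_add hτ0]; ring_nf

/-- `1/φ(qr) ≤ τ(q) τ(r) / (q r)` for `q, r ≥ 1`. [folklore] -/
theorem inv_totient_mul_le {q r : ℕ} (hq : 0 < q) (hr : 0 < r) :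
    ((Nat.totient (q * r) : ℝ))⁻¹ ≤ (σ 0 q : ℝ) * (σ 0 r : ℝ) / ((q : ℝ) * r) := by
  refine (inv_totient_le_sigma_zero_div (q * r)).trans ?_
  rw [Nat.cast_mul]
  gcongr
  exact_mod_cast sigma_zero_mul_le q r

/-- **The trivial bound for a sparsely supported weight** (the estimate behind BFI (12.1), p. 236:
"The relevant correction in `𝒟(M, N, Q, R)` is bounded by `O(‖β‖ N^{1/2} M x^{−ε/2})`").  If
`|w| ≤ 1`, `w` vanishes on `S` outside a set `T`, every `m n - a` (`m ∈ T`, `n ∼ N`) is a positive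
integer with `τ(mn - a) ≤ D₀`, and `|γ_q| ≤ τ(q)^B`, `|δ_r| ≤ τ(r)^B`, then
`|dispDw(w)| ≤ #T · ∑_n |β_n| · (D₀^{2B+2} + (∑_{q∼Q} τ(q)^{B+1}/q)(∑_{r∼R} τ(r)^{B+1}/r))`:
the congruence sums are bounded through `∑_{qr ∣ mn−a} τ(q)^B τ(r)^B ≤ τ(mn−a)^{2B+2}`, the
coprimality sums through `1/φ(qr) ≤ τ(q)τ(r)/(qr)`.
[cite: BombieriFriedlanderIwaniecActa1986, §12 (12.1) p. 236] -/
theorem abs_dispDw_le_of_support {a : ℤ} {S T : Finset ℕ} {N Q R B D₀ : ℝ}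
    (hQ : 0 ≤ Q) (hR : 0 ≤ R) (hB : 0 ≤ B) {w β γ δ : ℕ → ℝ} (hw : ∀ m, |w m| ≤ 1)
    (hwT : ∀ m ∈ S, w m ≠ 0 → m ∈ T)
    (hTa : ∀ m ∈ T, ∀ n ∈ dyadic N, a < ((m * n : ℕ) : ℤ))
    (hD₀ : 1 ≤ D₀)
    (hD : ∀ m ∈ T, ∀ n ∈ dyadic N, (σ 0 ((((m * n : ℕ) : ℤ) - a).toNat) : ℝ) ≤ D₀)
    (hγ : ∀ q, |γ q| ≤ (σ 0 q : ℝ) ^ B) (hδ : ∀ r, |δ r| ≤ (σ 0 r : ℝ) ^ B) :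
    |dispDw a S N Q R w β γ δ| ≤
      #T * (∑ n ∈ dyadic N, |β n|) *
        (D₀ ^ (2 * B + 2) +
          (∑ q ∈ dyadic Q, (σ 0 q : ℝ) ^ (B + 1) / q) *
            (∑ r ∈ dyadic R, (σ 0 r : ℝ) ^ (B + 1) / r)) := by
  set β₁ : ℝ := ∑ n ∈ dyadic N, |β n| with hβ₁
  have hβ₁0 : 0 ≤ β₁ := Finset.sum_nonneg fun n _ => abs_nonneg _
  clear_value β₁
  have hD₀0 : 0 < D₀ := by linarith
  -- the two inner sums and their bounds
  set U : ℕ → ℝ := fun k =>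
    ∑ m ∈ T, ∑ n ∈ dyadic N, if (k : ℤ) ∣ ((m * n : ℕ) : ℤ) - a then |β n| else 0 with hU
  have hU0 : ∀ k, 0 ≤ U k := fun k =>
    Finset.sum_nonneg fun m _ => Finset.sum_nonneg fun n _ => by positivity
  have hST : S.filter (fun m => w m ≠ 0) ⊆ T := fun m hm => by
    rw [Finset.mem_filter] at hm
    exact hwT m hm.1 hm.2
  have hL1 : ∀ k : ℕ,
      |∑ m ∈ S, ∑ n ∈ dyadic N,
          (if ((m * n : ℕ) : ZMod k) = (a : ZMod k) then w m * β n else 0)| ≤ U k := by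
    intro k
    refine (Finset.abs_sum_le_sum_abs _ _).trans ?_
    rw [← Finset.sum_filter_of_ne (p := fun m => w m ≠ 0) (fun m _ hm => ?_)]
    · refine le_trans (Finset.sum_le_sum_of_subset_of_nonneg hST ?_) (Finset.sum_le_sum fun m _ => ?_)
      · intro m _ _; exact abs_nonneg _
      · refine (Finset.abs_sum_le_sum_abs _ _).trans (Finset.sum_le_sum fun n _ => ?_)
        split_ifs with h1 h2
        · rw [abs_mul]
          exact mul_le_of_le_one_left (abs_nonneg _) (hw m)
        · exact absurd (int_dvd_of_natCast_mul_eq h1) h2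
        · simp
        · simp
    · intro h0
      apply hm
      rw [Finset.sum_eq_zero fun n _ => by rw [h0]; simp, abs_zero]
  have hL2 : ∀ k : ℕ,
      |∑ m ∈ S, ∑ n ∈ dyadic N, (if (m * n).Coprime k then w m * β n else 0)| ≤ #T * β₁ := by
    intro k
    refine (Finset.abs_sum_le_sum_abs _ _).trans ?_
    rw [← Finset.sum_filter_of_ne (p := fun m => w m ≠ 0) (fun m _ hm => ?_)]
    · calc ∑ m ∈ S.filter (fun m => w m ≠ 0),
            |∑ n ∈ dyadic N, (if (m * n).Coprime k then w m * β n else 0)|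
          ≤ ∑ m ∈ S.filter (fun m => w m ≠ 0), β₁ := by
            refine Finset.sum_le_sum fun m _ => ?_
            rw [hβ₁]
            refine (Finset.abs_sum_le_sum_abs _ _).trans (Finset.sum_le_sum fun n _ => ?_)
            split_ifs
            · rw [abs_mul]
              exact mul_le_of_le_one_left (abs_nonneg _) (hw m)
            · simp
        _ = #(S.filter (fun m => w m ≠ 0)) * β₁ := by rw [Finset.sum_const, nsmul_eq_mul]
        _ ≤ #T * β₁ :=
            mul_le_mul_of_nonneg_right (by exact_mod_cast Finset.card_le_card hST) hβ₁0
    · intro h0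
      apply hm
      rw [Finset.sum_eq_zero fun n _ => by rw [h0]; simp, abs_zero]
  -- Step 1: termwise
  have hterm : ∀ q ∈ dyadic Q, ∀ r ∈ dyadic R,
      |(if IsCoprime ((q * r : ℕ) : ℤ) a then
          γ q * δ r *
            ((∑ m ∈ S, ∑ n ∈ dyadic N,
                if ((m * n : ℕ) : ZMod (q * r)) = (a : ZMod (q * r)) then w m * β n else 0) -
              (∑ m ∈ S, ∑ n ∈ dyadic N,
                if (m * n).Coprime (q * r) then w m * β n else 0) / (Nat.totient (q * r) : ℝ))
        else 0)| ≤
        (σ 0 q : ℝ) ^ B * (σ 0 r : ℝ) ^ B * U (q * r) +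
          #T * β₁ * ((σ 0 q : ℝ) ^ (B + 1) / q * ((σ 0 r : ℝ) ^ (B + 1) / r)) := by
    intro q hq r hr
    have hq0 : 0 < q := pos_of_mem_dyadic hQ hq
    have hr0 : 0 < r := pos_of_mem_dyadic hR hr
    have hσq : (0 : ℝ) < (σ 0 q : ℝ) := by exact_mod_cast one_le_sigma_zero hq0.ne'
    have hσr : (0 : ℝ) < (σ 0 r : ℝ) := by exact_mod_cast one_le_sigma_zero hr0.ne'
    have hA : 0 ≤ (σ 0 q : ℝ) ^ B * (σ 0 r : ℝ) ^ B * U (q * r) := by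
      have := hU0 (q * r); positivity
    have hB' : 0 ≤ #T * β₁ * ((σ 0 q : ℝ) ^ (B + 1) / q * ((σ 0 r : ℝ) ^ (B + 1) / r)) := by
      positivity
    split_ifs with hcop
    · rw [abs_mul, abs_mul]
      have hγδ : |γ q| * |δ r| ≤ (σ 0 q : ℝ) ^ B * (σ 0 r : ℝ) ^ B :=
        mul_le_mul (hγ q) (hδ r) (abs_nonneg _) (by positivity)
      refine (mul_le_mul_of_nonneg_right hγδ (abs_nonneg _)).trans ?_
      refine (mul_le_mul_of_nonneg_left (abs_sub _ _) (by positivity)).trans ?_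
      rw [mul_add]
      refine add_le_add (mul_le_mul_of_nonneg_left (hL1 (q * r)) (by positivity)) ?_
      rw [abs_div, Nat.abs_cast, div_eq_mul_inv]
      calc (σ 0 q : ℝ) ^ B * (σ 0 r : ℝ) ^ B *
            (|∑ m ∈ S, ∑ n ∈ dyadic N, (if (m * n).Coprime (q * r) then w m * β n else 0)| *
              ((Nat.totient (q * r) : ℝ))⁻¹)
          ≤ (σ 0 q : ℝ) ^ B * (σ 0 r : ℝ) ^ B *
              (#T * β₁ * ((σ 0 q : ℝ) * (σ 0 r : ℝ) / ((q : ℝ) * r))) := by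
            gcongr
            · exact hL2 (q * r)
            · exact inv_totient_mul_le hq0 hr0
        _ = #T * β₁ * (((σ 0 q : ℝ) ^ B * σ 0 q) / q * (((σ 0 r : ℝ) ^ B * σ 0 r) / r)) := by
            field_simp
        _ = #T * β₁ * ((σ 0 q : ℝ) ^ (B + 1) / q * ((σ 0 r : ℝ) ^ (B + 1) / r)) := by
            rw [← Real.rpow_add_one hσq.ne', ← Real.rpow_add_one hσr.ne']
    · rw [abs_zero]; positivity
  -- Step 2: the divisor-counting bound for `∑_{q,r} τ(q)^B τ(r)^B U(qr)`
  have hmain : ∑ q ∈ dyadic Q, ∑ r ∈ dyadic R, (σ 0 q : ℝ) ^ B * (σ 0 r : ℝ) ^ B * U (q * r) ≤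
      #T * β₁ * D₀ ^ (2 * B + 2) := by
    -- exchange the order of summation
    have hex : ∑ q ∈ dyadic Q, ∑ r ∈ dyadic R, (σ 0 q : ℝ) ^ B * (σ 0 r : ℝ) ^ B * U (q * r) =
        ∑ m ∈ T, ∑ n ∈ dyadic N, |β n| * ∑ q ∈ dyadic Q, ∑ r ∈ dyadic R,
          (if ((q * r : ℕ) : ℤ) ∣ ((m * n : ℕ) : ℤ) - a then
            (σ 0 q : ℝ) ^ B * (σ 0 r : ℝ) ^ B else 0) := by
      have e1 : ∀ q r : ℕ, (σ 0 q : ℝ) ^ B * (σ 0 r : ℝ) ^ B * U (q * r) =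
          ∑ m ∈ T, ∑ n ∈ dyadic N, (if ((q * r : ℕ) : ℤ) ∣ ((m * n : ℕ) : ℤ) - a then
            (σ 0 q : ℝ) ^ B * (σ 0 r : ℝ) ^ B * |β n| else 0) := by
        intro q r
        simp only [hU, Finset.mul_sum]
        refine Finset.sum_congr rfl fun m _ => Finset.sum_congr rfl fun n _ => ?_
        split_ifs <;> ring
      have e2 : ∀ m n : ℕ, |β n| * ∑ q ∈ dyadic Q, ∑ r ∈ dyadic R,
          (if ((q * r : ℕ) : ℤ) ∣ ((m * n : ℕ) : ℤ) - a then
            (σ 0 q : ℝ) ^ B * (σ 0 r : ℝ) ^ B else 0) =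
          ∑ q ∈ dyadic Q, ∑ r ∈ dyadic R, (if ((q * r : ℕ) : ℤ) ∣ ((m * n : ℕ) : ℤ) - a then
            (σ 0 q : ℝ) ^ B * (σ 0 r : ℝ) ^ B * |β n| else 0) := by
        intro m n
        simp only [Finset.mul_sum]
        refine Finset.sum_congr rfl fun q _ => Finset.sum_congr rfl fun r _ => ?_
        split_ifs <;> ring
      simp_rw [e1, e2]
      simp_rw [Finset.sum_comm (s := dyadic R) (t := T)]
      rw [Finset.sum_comm (s := dyadic Q) (t := T)]
      simp_rw [Finset.sum_comm (s := dyadic R) (t := dyadic N)]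
      simp_rw [Finset.sum_comm (s := dyadic Q) (t := dyadic N)]
    rw [hex]
    have hin : ∀ m ∈ T, ∀ n ∈ dyadic N,
        |β n| * ∑ q ∈ dyadic Q, ∑ r ∈ dyadic R,
            (if ((q * r : ℕ) : ℤ) ∣ ((m * n : ℕ) : ℤ) - a then
              (σ 0 q : ℝ) ^ B * (σ 0 r : ℝ) ^ B else 0) ≤ |β n| * D₀ ^ (2 * B + 2) := by
      intro m hm n hn
      refine mul_le_mul_of_nonneg_left ?_ (abs_nonneg _)
      set l : ℕ := (((m * n : ℕ) : ℤ) - a).toNat with hl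
      have hlpos : 0 < ((m * n : ℕ) : ℤ) - a := by linarith [hTa m hm n hn]
      have hlcast : (l : ℤ) = ((m * n : ℕ) : ℤ) - a := Int.toNat_of_nonneg hlpos.le
      have hl0 : l ≠ 0 := by
        intro h0; rw [h0, Nat.cast_zero] at hlcast; linarith
      have hiff : ∀ q r : ℕ, ((q * r : ℕ) : ℤ) ∣ ((m * n : ℕ) : ℤ) - a ↔ q * r ∣ l := by
        intro q r
        rw [← hlcast, Int.natCast_dvd_natCast]
      simp only [hiff]
      calc ∑ q ∈ dyadic Q, ∑ r ∈ dyadic R,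
            (if q * r ∣ l then (σ 0 q : ℝ) ^ B * (σ 0 r : ℝ) ^ B else 0)
          ≤ (σ 0 l : ℝ) ^ (2 * B + 2) := sum_dyadic_dvd_rpow_le hl0 Q R hB
        _ ≤ D₀ ^ (2 * B + 2) := by
            refine Real.rpow_le_rpow (by positivity) (hD m hm n hn) (by linarith)
    calc ∑ m ∈ T, ∑ n ∈ dyadic N, |β n| * ∑ q ∈ dyadic Q, ∑ r ∈ dyadic R,
            (if ((q * r : ℕ) : ℤ) ∣ ((m * n : ℕ) : ℤ) - a then
              (σ 0 q : ℝ) ^ B * (σ 0 r : ℝ) ^ B else 0)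
        ≤ ∑ m ∈ T, ∑ n ∈ dyadic N, |β n| * D₀ ^ (2 * B + 2) :=
          Finset.sum_le_sum fun m hm => Finset.sum_le_sum fun n hn => hin m hm n hn
      _ = #T * β₁ * D₀ ^ (2 * B + 2) := by
          rw [Finset.sum_const, nsmul_eq_mul, hβ₁, ← Finset.sum_mul]; ring
  -- Step 3: assemble
  calc |dispDw a S N Q R w β γ δ|
      ≤ ∑ q ∈ dyadic Q, ∑ r ∈ dyadic R,
          ((σ 0 q : ℝ) ^ B * (σ 0 r : ℝ) ^ B * U (q * r) +
            #T * β₁ * ((σ 0 q : ℝ) ^ (B + 1) / q * ((σ 0 r : ℝ) ^ (B + 1) / r))) := by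
        unfold dispDw
        refine (Finset.abs_sum_le_sum_abs _ _).trans (Finset.sum_le_sum fun q hq => ?_)
        exact (Finset.abs_sum_le_sum_abs _ _).trans (Finset.sum_le_sum fun r hr => hterm q hq r hr)
    _ = (∑ q ∈ dyadic Q, ∑ r ∈ dyadic R, (σ 0 q : ℝ) ^ B * (σ 0 r : ℝ) ^ B * U (q * r)) +
          #T * β₁ * ((∑ q ∈ dyadic Q, (σ 0 q : ℝ) ^ (B + 1) / q) *
            (∑ r ∈ dyadic R, (σ 0 r : ℝ) ^ (B + 1) / r)) := by
        have e1 : ∑ q ∈ dyadic Q, ∑ r ∈ dyadic R,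
            ((σ 0 q : ℝ) ^ B * (σ 0 r : ℝ) ^ B * U (q * r) +
              #T * β₁ * ((σ 0 q : ℝ) ^ (B + 1) / q * ((σ 0 r : ℝ) ^ (B + 1) / r))) =
            (∑ q ∈ dyadic Q, ∑ r ∈ dyadic R, (σ 0 q : ℝ) ^ B * (σ 0 r : ℝ) ^ B * U (q * r)) +
              ∑ q ∈ dyadic Q, ∑ r ∈ dyadic R,
                #T * β₁ * ((σ 0 q : ℝ) ^ (B + 1) / q * ((σ 0 r : ℝ) ^ (B + 1) / r)) := by
          rw [← Finset.sum_add_distrib]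
          exact Finset.sum_congr rfl fun q _ => Finset.sum_add_distrib
        have e2 : ∑ q ∈ dyadic Q, ∑ r ∈ dyadic R,
            #T * β₁ * ((σ 0 q : ℝ) ^ (B + 1) / q * ((σ 0 r : ℝ) ^ (B + 1) / r)) =
            #T * β₁ * ((∑ q ∈ dyadic Q, (σ 0 q : ℝ) ^ (B + 1) / q) *
              (∑ r ∈ dyadic R, (σ 0 r : ℝ) ^ (B + 1) / r)) := by
          rw [Finset.sum_mul_sum, Finset.mul_sum]
          exact Finset.sum_congr rfl fun q _ => by rw [Finset.mul_sum]
        rw [e1, e2]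
    _ ≤ #T * β₁ * D₀ ^ (2 * B + 2) +
          #T * β₁ * ((∑ q ∈ dyadic Q, (σ 0 q : ℝ) ^ (B + 1) / q) *
            (∑ r ∈ dyadic R, (σ 0 r : ℝ) ^ (B + 1) / r)) := by gcongr
    _ = _ := by ring


/-! ### The smooth weight `α(m)` of BFI §12 (p. 235–236) -/

/-- A uniform bound `K_n ≥ 1` for the derivatives of orders `≤ n` of Mathlib's transition function
`ψ = Real.smoothTransition` (chosen once and for all, by
`FriedlanderIwaniecPrimes.exists_bound_iteratedFDeriv_smoothTransition`). [folklore] -/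
def derivConst (n : ℕ) : ℝ :=
  Classical.choose (FriedlanderIwaniecPrimes.exists_bound_iteratedFDeriv_smoothTransition n)

/-- `1 ≤ K_n`. [folklore] -/
theorem one_le_derivConst (n : ℕ) : 1 ≤ derivConst n :=
  (Classical.choose_spec (FriedlanderIwaniecPrimes.exists_bound_iteratedFDeriv_smoothTransition n)).1

/-- `|ψ⁽ⁱ⁾(s)| ≤ K_n` for `i ≤ n`. [folklore] -/
theorem norm_iteratedDeriv_smoothTransition_le {i n : ℕ} (hi : i ≤ n) (s : ℝ) :
    ‖iteratedDeriv i Real.smoothTransition s‖ ≤ derivConst n := by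
  rw [← norm_iteratedFDeriv_eq_norm_iteratedDeriv]
  exact (Classical.choose_spec
    (FriedlanderIwaniecPrimes.exists_bound_iteratedFDeriv_smoothTransition n)).2 i hi s

/-- **The smoothed weight `α`** replacing `α_m ≡ 1_{m ∼ M}` in BFI §12 (p. 235: "we replace `α_m` by
a smooth function `α(m)`, say, whose graph is" [figure: `1` on `[M, 2M]`, decreasing to `0` on both
sides]): `α(u) = ψ((u − M + Y)/Y) + ψ((2M + Y − u)/Y) − 1` with `ψ = Real.smoothTransition`; it is
smooth, takes values in `[0, 1]`, equals `1` on `[M, 2M]` and `0` outside `(M − Y, 2M + Y)`.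
[cite: BombieriFriedlanderIwaniecActa1986, §12 p. 235–236] -/
def bump (M Y : ℝ) (u : ℝ) : ℝ :=
  Real.smoothTransition (Y⁻¹ * (u + (Y - M))) +
    Real.smoothTransition ((-Y⁻¹) * (u + -(2 * M + Y))) - 1

/-- `α = 1` on `[M, 2M]`. [folklore] -/
theorem bump_eq_one {M Y u : ℝ} (hY : 0 < Y) (h1 : M ≤ u) (h2 : u ≤ 2 * M) : bump M Y u = 1 := by
  unfold bump
  rw [Real.smoothTransition.one_of_one_le, Real.smoothTransition.one_of_one_le]
  · ring
  · rw [neg_mul, ← mul_neg, le_inv_mul_iff₀ hY]; linarith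
  · rw [le_inv_mul_iff₀ hY]; linarith

/-- `α = 0` to the left of `M − Y`. [folklore] -/
theorem bump_eq_zero_of_le {M Y u : ℝ} (hY : 0 < Y) (hM : 0 ≤ M) (h : u ≤ M - Y) :
    bump M Y u = 0 := by
  unfold bump
  rw [Real.smoothTransition.zero_of_nonpos, Real.smoothTransition.one_of_one_le]
  · ring
  · rw [neg_mul, ← mul_neg, le_inv_mul_iff₀ hY]; linarith
  · rw [inv_mul_le_iff₀ hY]; linarith

/-- `α = 0` to the right of `2M + Y`. [folklore] -/
theorem bump_eq_zero_of_ge {M Y u : ℝ} (hY : 0 < Y) (hM : 0 ≤ M) (h : 2 * M + Y ≤ u) :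
    bump M Y u = 0 := by
  unfold bump
  rw [Real.smoothTransition.one_of_one_le, Real.smoothTransition.zero_of_nonpos]
  · ring
  · rw [neg_mul, ← mul_neg, inv_mul_le_iff₀ hY]; linarith
  · rw [le_inv_mul_iff₀ hY]; linarith

/-- `0 ≤ α ≤ 1`. [folklore] -/
theorem bump_mem_Icc {M Y : ℝ} (hY : 0 < Y) (hM : 0 ≤ M) (u : ℝ) : bump M Y u ∈ Set.Icc (0 : ℝ) 1 := by
  unfold bump
  have h1 := Real.smoothTransition.nonneg (Y⁻¹ * (u + (Y - M)))
  have h2 := Real.smoothTransition.le_one (Y⁻¹ * (u + (Y - M)))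
  have h3 := Real.smoothTransition.nonneg ((-Y⁻¹) * (u + -(2 * M + Y)))
  have h4 := Real.smoothTransition.le_one ((-Y⁻¹) * (u + -(2 * M + Y)))
  refine ⟨?_, by linarith⟩
  rcases le_total u M with hu | hu
  · rw [Real.smoothTransition.one_of_one_le (x := (-Y⁻¹) * (u + -(2 * M + Y)))]
    · linarith
    · rw [neg_mul, ← mul_neg, le_inv_mul_iff₀ hY]; linarith
  · rw [Real.smoothTransition.one_of_one_le (x := Y⁻¹ * (u + (Y - M)))]
    · linarith
    · rw [le_inv_mul_iff₀ hY]; linarith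

/-- `|α| ≤ 1`. [folklore] -/
theorem abs_bump_le_one {M Y : ℝ} (hY : 0 < Y) (hM : 0 ≤ M) (u : ℝ) : |bump M Y u| ≤ 1 := by
  have h := bump_mem_Icc hY hM u
  rw [abs_le]; constructor <;> linarith [h.1, h.2]

/-- `α` is smooth. [folklore] -/
theorem contDiff_bump (M Y : ℝ) : ContDiff ℝ ∞ (bump M Y) := by
  unfold bump
  refine ContDiff.sub (ContDiff.add ?_ ?_) contDiff_const
  · exact Real.smoothTransition.contDiff.comp
      (contDiff_const.mul (contDiff_id.add contDiff_const))
  · exact Real.smoothTransition.contDiff.comp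
      (contDiff_const.mul (contDiff_id.add contDiff_const))

/-- The derivatives of `α` of order `n ≥ 1` (chain rule for the two affine arguments):
`α⁽ⁿ⁾(u) = Y⁻ⁿ ψ⁽ⁿ⁾((u − M + Y)/Y) + (−Y⁻¹)ⁿ ψ⁽ⁿ⁾((2M + Y − u)/Y)`. [folklore] -/
theorem iteratedDeriv_bump {n : ℕ} (hn : 1 ≤ n) (M Y u : ℝ) :
    iteratedDeriv n (bump M Y) u =
      Y⁻¹ ^ n * iteratedDeriv n Real.smoothTransition (Y⁻¹ * (u + (Y - M))) +
        (-Y⁻¹) ^ n * iteratedDeriv n Real.smoothTransition ((-Y⁻¹) * (u + -(2 * M + Y))) := by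
  have hψ : ContDiff ℝ n Real.smoothTransition := Real.smoothTransition.contDiff
  set g₁ : ℝ → ℝ := fun u => Real.smoothTransition (Y⁻¹ * (u + (Y - M))) with hg₁
  set g₂ : ℝ → ℝ := fun u => Real.smoothTransition ((-Y⁻¹) * (u + -(2 * M + Y))) with hg₂
  have hc₁ : ContDiff ℝ n g₁ := hψ.comp (contDiff_const.mul (contDiff_id.add contDiff_const))
  have hc₂ : ContDiff ℝ n g₂ := hψ.comp (contDiff_const.mul (contDiff_id.add contDiff_const))
  have hfun : bump M Y = fun u => (g₁ u + g₂ u) - (fun _ : ℝ => (1 : ℝ)) u := by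
    funext v; rfl
  rw [hfun, iteratedDeriv_fun_sub (hc₁.add hc₂).contDiffAt contDiff_const.contDiffAt,
    iteratedDeriv_fun_add hc₁.contDiffAt hc₂.contDiffAt, iteratedDeriv_const]
  rw [if_neg (by omega), sub_zero]
  have e₁ : iteratedDeriv n g₁ u =
      Y⁻¹ ^ n * iteratedDeriv n Real.smoothTransition (Y⁻¹ * (u + (Y - M))) := by
    have h := congrFun (iteratedDeriv_comp_add_const n
      (fun w => Real.smoothTransition (Y⁻¹ * w)) (Y - M)) u
    rw [iteratedDeriv_comp_const_mul hψ] at h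
    exact h
  have e₂ : iteratedDeriv n g₂ u =
      (-Y⁻¹) ^ n * iteratedDeriv n Real.smoothTransition ((-Y⁻¹) * (u + -(2 * M + Y))) := by
    have h := congrFun (iteratedDeriv_comp_add_const n
      (fun w => Real.smoothTransition ((-Y⁻¹) * w)) (-(2 * M + Y))) u
    rw [iteratedDeriv_comp_const_mul hψ] at h
    exact h
  rw [e₁, e₂]

/-- **`|α⁽ⁿ⁾| ≤ 2 K_n Y⁻ⁿ`** for `n ≥ 1` (`f⁽ʲ⁾(m) ≪ Y^{−j}`, the shape required by Lemma 2 of the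
source with `M` replaced by the length `Y` of the transition). [folklore] -/
theorem norm_iteratedDeriv_bump_le {n : ℕ} (hn : 1 ≤ n) {M Y : ℝ} (hY : 0 < Y) (u : ℝ) :
    ‖iteratedDeriv n (bump M Y) u‖ ≤ 2 * derivConst n * Y⁻¹ ^ n := by
  rw [iteratedDeriv_bump hn]
  refine (norm_add_le _ _).trans ?_
  rw [norm_mul, norm_mul, norm_pow, norm_pow, norm_neg, norm_inv, Real.norm_of_nonneg hY.le]
  have h1 := norm_iteratedDeriv_smoothTransition_le (le_refl n) (Y⁻¹ * (u + (Y - M)))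
  have h2 := norm_iteratedDeriv_smoothTransition_le (le_refl n) ((-Y⁻¹) * (u + -(2 * M + Y)))
  have hY' : 0 ≤ Y⁻¹ ^ n := by positivity
  nlinarith [mul_le_mul_of_nonneg_left h1 hY', mul_le_mul_of_nonneg_left h2 hY']

/-- For `n ≥ 1`, `α⁽ⁿ⁾` vanishes off `[M − Y, M] ∪ [2M, 2M + Y]` (there `α` is locally constant).
[folklore] -/
theorem iteratedDeriv_bump_eq_zero {n : ℕ} (hn : 1 ≤ n) {M Y u : ℝ} (hY : 0 < Y) (hM : 0 ≤ M)
    (hu : u < M - Y ∨ (M < u ∧ u < 2 * M) ∨ 2 * M + Y < u) :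
    iteratedDeriv n (bump M Y) u = 0 := by
  rw [iteratedDeriv_bump hn,
    FriedlanderIwaniecPrimes.iteratedDeriv_smoothTransition_eq_zero hn,
    FriedlanderIwaniecPrimes.iteratedDeriv_smoothTransition_eq_zero hn]
  · ring
  · -- the argument `(2M + Y - u)/Y`
    rw [neg_mul, ← mul_neg, neg_add, neg_neg]
    rcases hu with hu | hu | hu
    · right; rw [lt_inv_mul_iff₀ hY]; linarith
    · right; rw [lt_inv_mul_iff₀ hY]; linarith
    · left; rw [inv_mul_lt_iff₀ hY]; linarith
  · -- the argument `(u - M + Y)/Y`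
    rcases hu with hu | hu | hu
    · left; rw [inv_mul_lt_iff₀ hY]; linarith
    · right; rw [lt_inv_mul_iff₀ hY]; linarith
    · right; rw [lt_inv_mul_iff₀ hY]; linarith

/-! ### The complexified weight and its Fourier transform -/

/-- `α` as a complex-valued function (for Mathlib's Fourier transform). [folklore] -/
def bumpC (M Y : ℝ) (t : ℝ) : ℂ := (bump M Y t : ℂ)

/-- `bumpC` unfolded. [folklore] -/
theorem bumpC_apply (M Y t : ℝ) : bumpC M Y t = (bump M Y t : ℂ) := rfl

/-- `α_ℂ` is smooth. [folklore] -/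
theorem contDiff_bumpC (M Y : ℝ) : ContDiff ℝ ∞ (bumpC M Y) :=
  Complex.ofRealCLM.contDiff.comp (contDiff_bump M Y)

/-- `‖α_ℂ‖ ≤ 1`. [folklore] -/
theorem norm_bumpC_le_one {M Y : ℝ} (hY : 0 < Y) (hM : 0 ≤ M) (t : ℝ) : ‖bumpC M Y t‖ ≤ 1 := by
  rw [bumpC_apply, Complex.norm_real, Real.norm_eq_abs]
  exact abs_bump_le_one hY hM t

/-- `α_ℂ` vanishes outside `(M − Y, 2M + Y)`. [folklore] -/
theorem bumpC_eq_zero {M Y t : ℝ} (hY : 0 < Y) (hM : 0 ≤ M) (ht : t ≤ M - Y ∨ 2 * M + Y ≤ t) :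
    bumpC M Y t = 0 := by
  rw [bumpC_apply, Complex.ofReal_eq_zero]
  rcases ht with ht | ht
  · exact bump_eq_zero_of_le hY hM ht
  · exact bump_eq_zero_of_ge hY hM ht

/-- `α_ℂ` has compact support (inside `[M − Y, 2M + Y]`). [folklore] -/
theorem hasCompactSupport_bumpC {M Y : ℝ} (hY : 0 < Y) (hM : 0 ≤ M) :
    HasCompactSupport (bumpC M Y) := by
  refine HasCompactSupport.intro (isCompact_Icc (a := M - Y) (b := 2 * M + Y)) fun t ht => ?_
  rw [Set.mem_Icc, not_and_or, not_le, not_le] at ht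
  rcases ht with ht | ht
  · exact bumpC_eq_zero hY hM (Or.inl ht.le)
  · exact bumpC_eq_zero hY hM (Or.inr ht.le)

/-- The derivatives of `α_ℂ` are those of `α`: `‖α_ℂ⁽ⁿ⁾(t)‖ ≤ ‖α⁽ⁿ⁾(t)‖`. [folklore] -/
theorem norm_iteratedDeriv_bumpC_le (n : ℕ) (M Y t : ℝ) :
    ‖iteratedDeriv n (bumpC M Y) t‖ ≤ ‖iteratedDeriv n (bump M Y) t‖ := by
  rw [← norm_iteratedFDeriv_eq_norm_iteratedDeriv, ← norm_iteratedFDeriv_eq_norm_iteratedDeriv]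
  have h := ContinuousLinearMap.iteratedFDeriv_comp_left (x := t) (i := n) Complex.ofRealCLM
    ((contDiff_bump M Y).contDiffAt) (by exact_mod_cast le_top)
  have hfun : bumpC M Y = ⇑Complex.ofRealCLM ∘ bump M Y := rfl
  rw [hfun, h]
  refine (ContinuousLinearMap.norm_compContinuousMultilinearMap_le _ _).trans ?_
  rw [Complex.ofRealCLM_norm, one_mul]

/-- **`L¹` bound for the derivatives of the weight**: for `n ≥ 1`, `0 < Y`, `0 ≤ M`,
`∫ ‖α_ℂ⁽ⁿ⁾‖ ≤ 4 K_n Y^{1−n}` (the derivative is `≤ 2K_n Y⁻ⁿ` and lives on two intervals of length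
`Y`). [folklore] -/
theorem integral_norm_iteratedDeriv_bumpC_le {n : ℕ} (hn : 1 ≤ n) {M Y : ℝ} (hY : 0 < Y)
    (hM : 0 ≤ M) :
    ∫ t, ‖iteratedDeriv n (bumpC M Y) t‖ ≤ 4 * derivConst n * Y⁻¹ ^ n * Y := by
  set S : Set ℝ := Set.Icc (M - Y) M ∪ Set.Icc (2 * M) (2 * M + Y) with hS
  have hzero : ∀ t ∉ S, ‖iteratedDeriv n (bumpC M Y) t‖ = 0 := by
    intro t ht
    have ht' : t < M - Y ∨ (M < t ∧ t < 2 * M) ∨ 2 * M + Y < t := by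
      simp only [hS, Set.mem_union, Set.mem_Icc, not_or, not_and_or, not_le] at ht
      rcases ht with ⟨h1 | h1, h2 | h2⟩
      · exact Or.inl h1
      · exact Or.inl h1
      · exact Or.inr (Or.inl ⟨h1, h2⟩)
      · exact Or.inr (Or.inr h2)
    have h0 := iteratedDeriv_bump_eq_zero hn hY hM ht'
    have h := norm_iteratedDeriv_bumpC_le n M Y t
    rw [h0, norm_zero] at h
    exact le_antisymm h (norm_nonneg _)
  rw [← setIntegral_eq_integral_of_forall_compl_eq_zero hzero]
  have hvolle : volume S ≤ ENNReal.ofReal (2 * Y) := by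
    refine (measure_union_le _ _).trans ?_
    rw [Real.volume_Icc, Real.volume_Icc, ← ENNReal.ofReal_add (by linarith) (by linarith)]
    refine ENNReal.ofReal_le_ofReal ?_
    linarith
  have hvol : volume S < ⊤ := lt_of_le_of_lt hvolle ENNReal.ofReal_lt_top
  have hb := norm_setIntegral_le_of_norm_le_const hvol
    (f := fun t => ‖iteratedDeriv n (bumpC M Y) t‖) (C := 2 * derivConst n * Y⁻¹ ^ n)
    (fun t _ => by
      rw [norm_norm]
      exact (norm_iteratedDeriv_bumpC_le n M Y t).trans (norm_iteratedDeriv_bump_le hn hY t))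
  rw [Real.norm_of_nonneg (integral_nonneg fun _ => norm_nonneg _)] at hb
  refine hb.trans ?_
  have hreal : volume.real S ≤ 2 * Y := by
    rw [Measure.real]
    refine (ENNReal.toReal_mono ENNReal.ofReal_ne_top hvolle).trans ?_
    rw [ENNReal.toReal_ofReal (by linarith)]
  have hK : 0 ≤ 2 * derivConst n * Y⁻¹ ^ n := by
    have := one_le_derivConst n; positivity
  calc 2 * derivConst n * Y⁻¹ ^ n * volume.real S ≤ 2 * derivConst n * Y⁻¹ ^ n * (2 * Y) :=
        mul_le_mul_of_nonneg_left hreal hK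
    _ = 4 * derivConst n * Y⁻¹ ^ n * Y := by ring

/-- **`L¹` bound for the weight**: `∫ ‖α_ℂ‖ ≤ M + 2Y` (`|α| ≤ 1` on `[M − Y, 2M + Y]`, `0` outside).
[folklore] -/
theorem integral_norm_bumpC_le {M Y : ℝ} (hY : 0 < Y) (hM : 0 ≤ M) :
    ∫ t, ‖bumpC M Y t‖ ≤ M + 2 * Y := by
  set S : Set ℝ := Set.Icc (M - Y) (2 * M + Y) with hS
  have hzero : ∀ t ∉ S, ‖bumpC M Y t‖ = 0 := by
    intro t ht
    rw [hS, Set.mem_Icc, not_and_or, not_le, not_le] at ht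
    rw [bumpC_eq_zero hY hM (ht.imp le_of_lt le_of_lt), norm_zero]
  rw [← setIntegral_eq_integral_of_forall_compl_eq_zero hzero]
  have hvol : volume S < ⊤ := by rw [hS, Real.volume_Icc]; exact ENNReal.ofReal_lt_top
  have hb := norm_setIntegral_le_of_norm_le_const hvol (f := fun t => ‖bumpC M Y t‖)
    (C := 1) (fun t _ => by rw [norm_norm]; exact norm_bumpC_le_one hY hM t)
  rw [Real.norm_of_nonneg (integral_nonneg fun _ => norm_nonneg _)] at hb
  refine hb.trans (le_of_eq ?_)
  rw [Measure.real, hS, Real.volume_Icc, ENNReal.toReal_ofReal (by linarith)]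
  ring

/-- `|𝓕α_ℂ(ξ)| ≤ M + 2Y` for every `ξ`. [folklore] -/
theorem norm_fourier_bumpC_le {M Y : ℝ} (hY : 0 < Y) (hM : 0 ≤ M) (ξ : ℝ) :
    ‖𝓕 (bumpC M Y) ξ‖ ≤ M + 2 * Y :=
  (FriedlanderIwaniecPrimes.norm_fourier_le_integral_norm _ ξ).trans (integral_norm_bumpC_le hY hM)

/-- **Fourier decay of the weight** (repeated partial integration): for `n ≥ 1` and `ξ ≠ 0`,
`|𝓕α_ℂ(ξ)| ≤ 4 K_n Y^{1−n} / (2π|ξ|)ⁿ`. [folklore] -/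
theorem norm_fourier_bumpC_le_of_ne_zero {n : ℕ} (hn : 1 ≤ n) {M Y : ℝ} (hY : 0 < Y) (hM : 0 ≤ M)
    {ξ : ℝ} (hξ : ξ ≠ 0) :
    ‖𝓕 (bumpC M Y) ξ‖ ≤ 4 * derivConst n * Y⁻¹ ^ n * Y / (2 * π * |ξ|) ^ n := by
  refine (FriedlanderIwaniecPrimes.norm_fourier_le_div (contDiff_bumpC M Y)
    (hasCompactSupport_bumpC hY hM) n hξ).trans ?_
  gcongr
  exact integral_norm_iteratedDeriv_bumpC_le hn hY hM


/-! ### The smoothing error `𝒟(1_{m∼M}) − 𝒟(α)` (BFI (12.1)) -/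

/-- The range of `m` carrying the smoothed sum: `0 ≤ m ≤ ⌊2M + Y⌋`. [folklore] -/
def mRange (M Y : ℝ) : Finset ℕ := Finset.range (⌊2 * M + Y⌋₊ + 1)

/-- `m ∈ mRange M Y ↔ m ≤ ⌊2M + Y⌋`. [folklore] -/
theorem mem_mRange {M Y : ℝ} {m : ℕ} : m ∈ mRange M Y ↔ m ≤ ⌊2 * M + Y⌋₊ := by
  rw [mRange, Finset.mem_range, Nat.lt_add_one_iff]

/-- `{m ∼ M} ⊆ mRange M Y` for `Y ≥ 0`. [folklore] -/
theorem dyadic_subset_mRange {M Y : ℝ} (hY : 0 ≤ Y) : dyadic M ⊆ mRange M Y := by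
  intro m hm
  rw [mem_mRange]
  have h := Finset.mem_range.1 (Finset.mem_filter.1 hm).1
  exact (Nat.lt_add_one_iff.1 h).trans (Nat.floor_mono (by linarith))

/-- Every natural number at which `α` does not vanish lies in `mRange M Y` (`0 < Y`, `0 ≤ M`).
[folklore] -/
theorem mem_mRange_of_bump_ne_zero {M Y : ℝ} (hY : 0 < Y) (hM : 0 ≤ M) {m : ℕ}
    (h : bump M Y m ≠ 0) : m ∈ mRange M Y := by
  rw [mem_mRange]
  by_contra hlt
  rw [not_le] at hlt
  have : 2 * M + Y ≤ (m : ℝ) := (Nat.lt_of_floor_lt hlt).le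
  exact h (bump_eq_zero_of_ge hY hM this)

/-- The finite set of `m` where `1_{m ∼ M}` and `α(m)` may differ:
`(⌊M − Y⌋, ⌊M⌋] ∪ (⌊2M⌋, ⌊2M + Y⌋]`. [folklore] -/
def bumpDiffSupport (M Y : ℝ) : Finset ℕ :=
  Finset.Ioc ⌊M - Y⌋₊ ⌊M⌋₊ ∪ Finset.Ioc ⌊2 * M⌋₊ ⌊2 * M + Y⌋₊

/-- `#((⌊u⌋, ⌊v⌋]) ≤ v − u + 1` for `0 ≤ u ≤ v`. [folklore] -/
theorem card_Ioc_floor_le {u v : ℝ} (hu : 0 ≤ u) (huv : u ≤ v) :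
    (#(Finset.Ioc ⌊u⌋₊ ⌊v⌋₊) : ℝ) ≤ v - u + 1 := by
  rw [Nat.card_Ioc]
  have h1 : (⌊v⌋₊ : ℝ) ≤ v := Nat.floor_le (hu.trans huv)
  have h2 : u < (⌊u⌋₊ : ℝ) + 1 := Nat.lt_floor_add_one u
  have h3 : ⌊u⌋₊ ≤ ⌊v⌋₊ := Nat.floor_mono huv
  rw [Nat.cast_sub h3]
  linarith

/-- `#bumpDiffSupport ≤ 2Y + 2` (`0 ≤ Y ≤ M`). [folklore] -/
theorem card_bumpDiffSupport_le {M Y : ℝ} (hY : 0 ≤ Y) (hYM : Y ≤ M) :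
    (#(bumpDiffSupport M Y) : ℝ) ≤ 2 * Y + 2 := by
  have hM : 0 ≤ M := hY.trans hYM
  calc (#(bumpDiffSupport M Y) : ℝ)
      ≤ #(Finset.Ioc ⌊M - Y⌋₊ ⌊M⌋₊) + #(Finset.Ioc ⌊2 * M⌋₊ ⌊2 * M + Y⌋₊) := by
        exact_mod_cast Finset.card_union_le _ _
    _ ≤ (M - (M - Y) + 1) + ((2 * M + Y) - 2 * M + 1) :=
        add_le_add (card_Ioc_floor_le (by linarith) (by linarith))
          (card_Ioc_floor_le (by linarith) (by linarith))
    _ = 2 * Y + 2 := by ring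

/-- Elements of `bumpDiffSupport M Y` exceed `M − Y` (`0 ≤ Y ≤ M`). [folklore] -/
theorem lt_of_mem_bumpDiffSupport {M Y : ℝ} (hY : 0 ≤ Y) (hYM : Y ≤ M) {m : ℕ}
    (hm : m ∈ bumpDiffSupport M Y) : M - Y < m := by
  rw [bumpDiffSupport, Finset.mem_union, Finset.mem_Ioc, Finset.mem_Ioc] at hm
  rcases hm with ⟨h, -⟩ | ⟨h, -⟩
  · exact Nat.lt_of_floor_lt h
  · have h' : 2 * M < m := Nat.lt_of_floor_lt h
    linarith

/-- Where `1_{m ∼ M}(m) ≠ α(m)`, `m ∈ bumpDiffSupport M Y` (`0 < Y ≤ M`). [folklore] -/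
theorem mem_bumpDiffSupport {M Y : ℝ} (hY : 0 < Y) (hYM : Y ≤ M) {m : ℕ}
    (h : (if m ∈ dyadic M then (1 : ℝ) else 0) - bump M Y m ≠ 0) : m ∈ bumpDiffSupport M Y := by
  have hM : 0 ≤ M := hY.le.trans hYM
  rw [bumpDiffSupport, Finset.mem_union, Finset.mem_Ioc, Finset.mem_Ioc]
  by_cases hm : m ∈ dyadic M
  · have hm' := (mem_dyadic hM).1 hm
    rw [if_pos hm, bump_eq_one hY hm'.1.le hm'.2] at h
    exact absurd (sub_self (1 : ℝ)) h
  · rw [if_neg hm, zero_sub, neg_ne_zero] at h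
    have h1 : M - Y < m := by
      by_contra hle; exact h (bump_eq_zero_of_le hY hM (not_lt.1 hle))
    have h2 : (m : ℝ) < 2 * M + Y := by
      by_contra hle; exact h (bump_eq_zero_of_ge hY hM (not_lt.1 hle))
    rw [mem_dyadic hM, not_and_or, not_lt, not_le] at hm
    rcases hm with hm | hm
    · left
      exact ⟨(Nat.floor_lt (by linarith)).2 h1, Nat.le_floor hm⟩
    · right
      exact ⟨(Nat.floor_lt (by linarith)).2 hm, Nat.le_floor h2.le⟩

/-- **The smoothing error (12.1)**: for `0 < Y ≤ M`, `|a| ≤ M − Y`, the difference between `𝒟` with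
`α ≡ 1` on `m ∼ M` and the smoothed `dispDw` with the weight `α(m)` on `mRange M Y` is at most
`(2Y + 2) ∑_n |β_n| (D₀^{2B+2} + (∑_{q∼Q} τ(q)^{B+1}/q)(∑_{r∼R} τ(r)^{B+1}/r))`, where `D₀` bounds
`τ(mn − a)` on the transition ranges.  (BFI bound this correction by Lemma 3; the pointwise divisor
bound suffices for Theorem 5 as vendored, the saving exponent being existential.)
[cite: BombieriFriedlanderIwaniecActa1986, §12 (12.1) p. 236] -/
theorem abs_dispD_sub_dispDw_bump_le {a : ℤ} {M Y N Q R B D₀ : ℝ} (hY : 0 < Y) (hYM : Y ≤ M)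
    (ha : (|a| : ℝ) ≤ M - Y) (hN : 0 ≤ N) (hQ : 0 ≤ Q) (hR : 0 ≤ R) (hB : 0 ≤ B) (hD₀ : 1 ≤ D₀)
    (hD : ∀ m ∈ bumpDiffSupport M Y, ∀ n ∈ dyadic N,
      (σ 0 ((((m * n : ℕ) : ℤ) - a).toNat) : ℝ) ≤ D₀)
    {β γ δ : ℕ → ℝ} (hγ : ∀ q, |γ q| ≤ (σ 0 q : ℝ) ^ B) (hδ : ∀ r, |δ r| ≤ (σ 0 r : ℝ) ^ B) :
    |dispD a M N Q R (fun _ => 1) β γ δ -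
        dispDw a (mRange M Y) N Q R (fun m => bump M Y m) β γ δ| ≤
      (2 * Y + 2) * (∑ n ∈ dyadic N, |β n|) *
        (D₀ ^ (2 * B + 2) +
          (∑ q ∈ dyadic Q, (σ 0 q : ℝ) ^ (B + 1) / q) *
            (∑ r ∈ dyadic R, (σ 0 r : ℝ) ^ (B + 1) / r)) := by
  have hM : 0 ≤ M := hY.le.trans hYM
  rw [← dispDw_indicator a (dyadic_subset_mRange hY.le) N Q R (fun _ => (1 : ℝ)) β γ δ,
    dispDw_sub]
  have hw : ∀ m : ℕ, |(if m ∈ dyadic M then (1 : ℝ) else 0) - bump M Y m| ≤ 1 := by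
    intro m
    have hb := bump_mem_Icc hY hM m
    rw [abs_le]
    split_ifs <;> constructor <;> linarith [hb.1, hb.2]
  have hTa : ∀ m ∈ bumpDiffSupport M Y, ∀ n ∈ dyadic N, a < ((m * n : ℕ) : ℤ) := by
    intro m hm n hn
    have hm' : M - Y < m := lt_of_mem_bumpDiffSupport hY.le hYM hm
    have hn' : (1 : ℕ) ≤ n := by
      have := ((mem_dyadic hN).1 hn).1
      exact_mod_cast (show (0 : ℝ) < n from hN.trans_lt this)
    have h1 : (|a| : ℝ) < m := ha.trans_lt hm'
    have h2 : (m : ℤ) ≤ ((m * n : ℕ) : ℤ) := by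
      have : m ≤ m * n := Nat.le_mul_of_pos_right m hn'
      exact_mod_cast this
    have h3 : |a| < (m : ℤ) := by exact_mod_cast h1
    linarith [le_abs_self a]
  calc |dispDw a (mRange M Y) N Q R
        (fun m => (if m ∈ dyadic M then (1 : ℝ) else 0) - bump M Y m) β γ δ|
      ≤ #(bumpDiffSupport M Y) * (∑ n ∈ dyadic N, |β n|) *
          (D₀ ^ (2 * B + 2) +
            (∑ q ∈ dyadic Q, (σ 0 q : ℝ) ^ (B + 1) / q) *
              (∑ r ∈ dyadic R, (σ 0 r : ℝ) ^ (B + 1) / r)) :=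
        abs_dispDw_le_of_support hQ hR hB hw (fun m _ hm => mem_bumpDiffSupport hY hYM hm)
          hTa hD₀ hD hγ hδ
    _ ≤ _ := by
        have h1 : 0 ≤ ∑ n ∈ dyadic N, |β n| := Finset.sum_nonneg fun n _ => abs_nonneg _
        have h2 : 0 ≤ D₀ ^ (2 * B + 2) +
            (∑ q ∈ dyadic Q, (σ 0 q : ℝ) ^ (B + 1) / q) *
              (∑ r ∈ dyadic R, (σ 0 r : ℝ) ^ (B + 1) / r) := by positivity
        have h3 := card_bumpDiffSupport_le hY.le hYM
        gcongr

end BFI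

end Literature.NumberTheory.Sieve
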